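import Mathlib.Analysis.Calculus.FDeriv.Symmetric
import Mathlib.Analysis.Calculus.ContDiff.Basic
import Mathlib.Analysis.Calculus.FDeriv.Prod
import Mathlib.Analysis.Calculus.Deriv.Prod

/-!
# Route EIHFluxBalance — `InertialRecession` (E′), skeleton r13, stub `stub_firstOrderSlaving` (D),
# part 4: the slice jet of a time-modulated field (abstract calculus)

Helper file for the crux `stmt-FinalStateConjecture-17403` (E′), stub (D). Pure calculus on a
product `ℝ × E`:

* `firstOrder_sliceJet` — **jets of a modulated field against the frozen field.** For `Φ : ℝ × E → F`
  of class `C²` at `(t, x)` and a covector `π` with `π x = t`, the modulated field `z ↦ Φ(π z, z)`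
  and the frozen field `z ↦ Φ(t, z)` have, at `x`, first derivatives differing by `π ⊗ V(x)` with
  `V(z) = ∂_s Φ(t, z)` the variation field, and second derivatives differing by
  `π(v) P + π ⊗ P(v) + π(v) π ⊗ W`, `P = DV(x)`, `W = ∂_s² Φ(t, x)` (chain rule through the
  linear map `z ↦ (π z, z)` and symmetry of `D²Φ`). This is the jet relation between the painted
  ansatz `g₀` and its inertial continuation frozen at lab time `t` (`π = dx⁰`).
* `firstOrder_jets_const_add_sum` — jets of `z ↦ C + Σⱼ (fⱼ z − C)` are the sums of the jets.
* `firstOrder_fderiv_curry_eq_deriv` — `∂_s Φ(t, z) = d/ds Φ(s, z)|_{s = t}`.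

Elementary; no definitions, no named facts.
-/

set_option linter.dupNamespace false

noncomputable section

open scoped Topology
open Filter Set Function

namespace Summit.FinalStateConjecture.FinalStateConjecture.Theorems.SublinearIsFree.Slaving

section SliceJet

variable {E F G : Type*} [NormedAddCommGroup E] [NormedSpace ℝ E] [NormedAddCommGroup F]
  [NormedSpace ℝ F] [NormedAddCommGroup G] [NormedSpace ℝ G]

/-- Splitting a linear map on `ℝ × E` along `(1, 0)` and `(0, v)`. [folklore] -/
theorem firstOrder_clm_prod_split (L : ℝ × E →L[ℝ] G) (r : ℝ) (v : E) :
    L (r, v) = L (0, v) + r • L (1, 0) := by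
  rw [← map_smul, ← map_add]
  congr 1
  ext <;> simp

/-- **The slice jet of a modulated field.** Let `Φ : ℝ × E → F` be `C²` at `(t, x)` and `π : E →L ℝ`
with `π x = t`. Then at `x` the modulated field `z ↦ Φ (π z, z)` and the frozen field `z ↦ Φ (t, z)`
satisfy `D(mod) = D(froz) + π ⊗ V(x)` and
`D²(mod)(v) = D²(froz)(v) + π(v) DV(x) + π ⊗ DV(x)(v) + π(v) π ⊗ W`, where
`V(z) = DΦ(t,z)(1,0)` and `W = D²Φ(t,x)(1,0)(1,0)`. [folklore] -/
theorem firstOrder_sliceJet {Φ : ℝ × E → F} {π : E →L[ℝ] ℝ} {x : E} {t : ℝ} (hπ : π x = t)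
    (hΦ : ContDiffAt ℝ 2 Φ (t, x)) :
    fderiv ℝ (fun z ↦ Φ (π z, z)) x =
        fderiv ℝ (fun z ↦ Φ (t, z)) x + π.smulRight (fderiv ℝ Φ (t, x) (1, 0)) ∧
    ∀ v, fderiv ℝ (fderiv ℝ (fun z ↦ Φ (π z, z))) x v =
        fderiv ℝ (fderiv ℝ (fun z ↦ Φ (t, z))) x v +
          (π v • fderiv ℝ (fun z ↦ fderiv ℝ Φ (t, z) (1, 0)) x +
            π.smulRight (fderiv ℝ (fun z ↦ fderiv ℝ Φ (t, z) (1, 0)) x v) +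
            π v • π.smulRight (fderiv ℝ (fderiv ℝ Φ) (t, x) (1, 0) (1, 0))) := by
  set ι : E →L[ℝ] ℝ × E := π.prod (ContinuousLinearMap.id ℝ E) with hιdef
  have hι : ∀ z, ι z = (π z, z) := fun z ↦ rfl
  have hιx : ι x = (t, x) := by rw [hι, hπ]
  set κ : E →L[ℝ] ℝ × E := (0 : E →L[ℝ] ℝ).prod (ContinuousLinearMap.id ℝ E) with hκdef
  have hκ : ∀ z, κ z = (0, z) := fun z ↦ rfl
  have hj : ∀ z : E, HasFDerivAt (fun z ↦ ((t, z) : ℝ × E)) κ z := fun z ↦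
    (hasFDerivAt_const t z).prodMk (hasFDerivAt_id z)
  -- differentiability near `(t, x)`
  have hev : ∀ᶠ p in 𝓝 (t, x), ContDiffAt ℝ 2 Φ p := hΦ.eventually (by simp)
  have hevι : ∀ᶠ z in 𝓝 x, DifferentiableAt ℝ Φ (ι z) := by
    have hc : Tendsto ι (𝓝 x) (𝓝 (t, x)) := by rw [← hιx]; exact ι.continuous.continuousAt
    exact (hc.eventually hev).mono fun z hz ↦ hz.differentiableAt (by norm_num)
  have hevj : ∀ᶠ z in 𝓝 x, DifferentiableAt ℝ Φ (t, z) := by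
    have hc : Tendsto (fun z ↦ ((t, z) : ℝ × E)) (𝓝 x) (𝓝 (t, x)) :=
      (continuous_const.prodMk continuous_id).continuousAt
    exact (hc.eventually hev).mono fun z hz ↦ hz.differentiableAt (by norm_num)
  -- first derivatives near `x`
  have hD1 : ∀ᶠ z in 𝓝 x, HasFDerivAt (fun z ↦ Φ (π z, z)) ((fderiv ℝ Φ (ι z)).comp ι) z :=
    hevι.mono fun z hz ↦ hz.hasFDerivAt.comp z ι.hasFDerivAt
  have hD1' : ∀ᶠ z in 𝓝 x, HasFDerivAt (fun z ↦ Φ (t, z)) ((fderiv ℝ Φ (t, z)).comp κ) z :=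
    hevj.mono fun z hz ↦ hz.hasFDerivAt.comp z (hj z)
  have hF1 : fderiv ℝ (fun z ↦ Φ (π z, z)) =ᶠ[𝓝 x] fun z ↦ (fderiv ℝ Φ (ι z)).comp ι :=
    hD1.mono fun z hz ↦ hz.fderiv
  have hF1' : fderiv ℝ (fun z ↦ Φ (t, z)) =ᶠ[𝓝 x] fun z ↦ (fderiv ℝ Φ (t, z)).comp κ :=
    hD1'.mono fun z hz ↦ hz.fderiv
  -- second derivatives at `x`
  have hD2 : HasFDerivAt (fderiv ℝ Φ) (fderiv ℝ (fderiv ℝ Φ) (t, x)) (t, x) :=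
    ((hΦ.fderiv_right (m := 1) (by norm_num)).differentiableAt one_ne_zero).hasFDerivAt
  have hD2ι : HasFDerivAt (fderiv ℝ Φ) (fderiv ℝ (fderiv ℝ Φ) (t, x)) (ι x) := by rwa [hιx]
  have Hmod : HasFDerivAt (fun z ↦ (fderiv ℝ Φ (ι z)).comp ι)
      ((ContinuousLinearMap.precomp F ι).comp ((fderiv ℝ (fderiv ℝ Φ) (t, x)).comp ι)) x := by
    have := (ContinuousLinearMap.precomp F ι).hasFDerivAt.comp x (hD2ι.comp x ι.hasFDerivAt)
    simpa only [Function.comp_def, ContinuousLinearMap.precomp_apply] using this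
  have Hfroz : HasFDerivAt (fun z ↦ (fderiv ℝ Φ (t, z)).comp κ)
      ((ContinuousLinearMap.precomp F κ).comp ((fderiv ℝ (fderiv ℝ Φ) (t, x)).comp κ)) x := by
    have := (ContinuousLinearMap.precomp F κ).hasFDerivAt.comp x (hD2.comp x (hj x))
    simpa only [Function.comp_def, ContinuousLinearMap.precomp_apply] using this
  have Hvar : HasFDerivAt (fun z ↦ fderiv ℝ Φ (t, z) (1, 0))
      ((ContinuousLinearMap.apply ℝ F ((1 : ℝ), (0 : E))).comp
        ((fderiv ℝ (fderiv ℝ Φ) (t, x)).comp κ)) x := by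
    have := (ContinuousLinearMap.apply ℝ F ((1 : ℝ), (0 : E))).hasFDerivAt.comp x (hD2.comp x (hj x))
    simpa only [Function.comp_def, ContinuousLinearMap.apply_apply] using this
  have hsymm : ∀ u u' : ℝ × E, fderiv ℝ (fderiv ℝ Φ) (t, x) u u' = fderiv ℝ (fderiv ℝ Φ) (t, x) u' u :=
    fun u u' ↦ hΦ.isSymmSndFDerivAt (by simp) u u'
  refine ⟨?_, fun v ↦ ?_⟩
  · rw [hD1.self_of_nhds.fderiv, hD1'.self_of_nhds.fderiv, hιx]
    ext v
    simp only [ContinuousLinearMap.comp_apply, hι, hκ, add_apply,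
      ContinuousLinearMap.smulRight_apply]
    exact firstOrder_clm_prod_split _ _ _
  · rw [hF1.fderiv_eq, hF1'.fderiv_eq, Hmod.fderiv, Hfroz.fderiv, Hvar.fderiv]
    ext w
    simp only [ContinuousLinearMap.comp_apply, ContinuousLinearMap.precomp_apply, hι, hκ,
      add_apply, smul_apply,
      ContinuousLinearMap.smulRight_apply, ContinuousLinearMap.apply_apply]
    rw [firstOrder_clm_prod_split (fderiv ℝ (fderiv ℝ Φ) (t, x)) (π v) v,
      add_apply, smul_apply,
      firstOrder_clm_prod_split (fderiv ℝ (fderiv ℝ Φ) (t, x) (0, v)) (π w) w,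
      firstOrder_clm_prod_split (fderiv ℝ (fderiv ℝ Φ) (t, x) (1, 0)) (π w) w,
      hsymm (1, 0) (0, w)]
    simp only [smul_add, smul_smul]
    abel

/-- **The variation field is the time derivative**: if `Φ` is differentiable at `(t, z)` then
`DΦ(t,z)(1,0) = d/ds Φ(s, z)|_{s=t}`. [folklore] -/
theorem firstOrder_hasDerivAt_curry {Φ : ℝ × E → F} {t : ℝ} {z : E}
    (hΦ : DifferentiableAt ℝ Φ (t, z)) :
    HasDerivAt (fun s ↦ Φ (s, z)) (fderiv ℝ Φ (t, z) (1, 0)) t := by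
  have hp : HasDerivAt (fun s : ℝ ↦ ((s, z) : ℝ × E)) ((1 : ℝ), (0 : E)) t := by
    have := HasDerivAt.prodMk (hasDerivAt_id t) (hasDerivAt_const t z)
    simpa using this
  exact hΦ.hasFDerivAt.comp_hasDerivAt t hp

end SliceJet

/-! ### Jets of a constant plus a finite sum of perturbations -/

section Sum

variable {E F : Type*} [NormedAddCommGroup E] [NormedSpace ℝ E] [NormedAddCommGroup F]
  [NormedSpace ℝ F]

/-- **Jets of `z ↦ C + Σⱼ (fⱼ z − C)`.** If every `fⱼ` is `C²` at `x` then
`D(C + Σⱼ(fⱼ − C))(x) = Σⱼ Dfⱼ(x)` and `D²(C + Σⱼ(fⱼ − C))(x)(v) = Σⱼ D²fⱼ(x)(v)`. [folklore] -/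
theorem firstOrder_jets_const_add_sum {ι : Type*} (s : Finset ι) {f : ι → E → F} {x : E} (C : F)
    (h : ∀ j ∈ s, ContDiffAt ℝ 2 (f j) x) :
    fderiv ℝ (fun z ↦ C + ∑ j ∈ s, (f j z - C)) x = ∑ j ∈ s, fderiv ℝ (f j) x ∧
    ∀ v, fderiv ℝ (fderiv ℝ (fun z ↦ C + ∑ j ∈ s, (f j z - C))) x v =
      ∑ j ∈ s, fderiv ℝ (fderiv ℝ (f j)) x v := by
  classical
  -- `C + Σ (fⱼ − C) = (C − Σ C) + Σ fⱼ`
  have hfun : (fun z ↦ C + ∑ j ∈ s, (f j z - C)) = fun z ↦ (C - ∑ _j ∈ s, C) + ∑ j ∈ s, f j z := by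
    funext z
    rw [Finset.sum_sub_distrib]
    abel
  have hD : fderiv ℝ (fun z ↦ C + ∑ j ∈ s, (f j z - C)) = fderiv ℝ (fun z ↦ ∑ j ∈ s, f j z) := by
    rw [hfun]
    funext z
    exact fderiv_const_add _
  -- differentiability
  have hev : ∀ᶠ z in 𝓝 x, ∀ j ∈ s, DifferentiableAt ℝ (f j) z := by
    have : ∀ j ∈ s, ∀ᶠ z in 𝓝 x, DifferentiableAt ℝ (f j) z := fun j hj ↦
      ((h j hj).eventually (by simp)).mono fun z hz ↦ hz.differentiableAt (by norm_num)
    exact (Finset.eventually_all s).2 this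
  have hd2 : ∀ j ∈ s, DifferentiableAt ℝ (fderiv ℝ (f j)) x := fun j hj ↦
    (((h j hj).fderiv_right (m := 1) (by norm_num)).differentiableAt one_ne_zero)
  have hsum : fderiv ℝ (fun z ↦ ∑ j ∈ s, f j z) =ᶠ[𝓝 x] fun z ↦ ∑ j ∈ s, fderiv ℝ (f j) z :=
    hev.mono fun z hz ↦ fderiv_fun_sum hz
  refine ⟨?_, fun v ↦ ?_⟩
  · rw [hD, fderiv_fun_sum hev.self_of_nhds]
  · rw [hD, hsum.fderiv_eq, fderiv_fun_sum hd2]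
    simp only [FunLike.coe_sum, Finset.sum_apply]

end Sum

/-- **Registered one-line carrier form** (`firstOrder_sliceJet_D4`, stub (D) of the crux item) of
`firstOrder_sliceJet`. [folklore] -/
theorem firstOrder_sliceJet_D4 : ∀ {E F : Type} [NormedAddCommGroup E] [NormedSpace ℝ E] [NormedAddCommGroup F] [NormedSpace ℝ F] {Φ : ℝ × E → F} {π : E →L[ℝ] ℝ} {x : E} {t : ℝ}, π x = t → ContDiffAt ℝ 2 Φ (t, x) → fderiv ℝ (fun z ↦ Φ (π z, z)) x = fderiv ℝ (fun z ↦ Φ (t, z)) x + π.smulRight (fderiv ℝ Φ (t, x) (1, 0)) ∧ ∀ v, fderiv ℝ (fderiv ℝ (fun z ↦ Φ (π z, z))) x v = fderiv ℝ (fderiv ℝ (fun z ↦ Φ (t, z))) x v + (π v • fderiv ℝ (fun z ↦ fderiv ℝ Φ (t, z) (1, 0)) x + π.smulRight (fderiv ℝ (fun z ↦ fderiv ℝ Φ (t, z) (1, 0)) x v) + π v • π.smulRight (fderiv ℝ (fderiv ℝ Φ) (t, x) (1, 0) (1, 0))) :=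
  fun hπ hΦ ↦ firstOrder_sliceJet hπ hΦ

end Summit.FinalStateConjecture.FinalStateConjecture.Theorems.SublinearIsFree.Slaving

end
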